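import Literature.NumberTheory.Automorphic.LocalHermitianFormsRankThree
import Literature.NumberTheory.Automorphic.LocalUnitaryGroupCongr
import HarnessLib

/-!
# E4 of `Cruxes/H413/Lines/F0_LocalAPackets.lean` §6: the non-split identification `U(H)(L⁺_v) ≃ₜ* U(Φ₃)(L⁺_v)` EXISTS,
# UNCONDITIONALLY (no named fact), and hence the identification exists at EVERY finite place

Cell hodgecm-mathlib, FLOOR 0, crux item H413 = stmt-HodgeConjecture-24833, sub-programme P3b, line `Cruxes/H413/Lines/F0_LocalAPackets.lean`
§6 (NON-SPLIT finite places: the packet `Π(ξ_v)` of the inner form `U(H)` is pulled back along an identification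
`e : U(H)(L⁺_v) ≃ₜ* U(Φ₃)(L⁺_v)` taken as DATA; planner F0P3b-plan (g5), ruling «E4-c DIRECT, E4-b FOLDED», A-p03 (g17)).  Namespace
`Summit.HodgeConjecture.HodgeConjecture.Cruxes.H413.F0P3bNonsplitIdentification`.  THEOREMS ONLY (no `def`, no instance, no notation,
no named fact, no `sorry`); imports ★ `Automorphic/LocalHermitianFormsRankThree` + ★ `Automorphic/LocalUnitaryGroupCongr` only; never imports
`Cruxes/…/Lines/…`.  DEBT 0: the odd-rank local classification of hermitian forms ([Jacobowitz1962, Thm. 3.1] «`H_v ≃ a • Φ₃`») that the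
census had budgeted as a named fact (NF2) or as new bytes (E4-c) is ALREADY A TREE THEOREM at rank `3`: ★
`UnitaryGroup.exists_isUnit_formCongr_map_eq_smul_antidiag_of_smul_eq` (`LocalHermitianFormsRankThree.lean`, written for the T1 engine's
`stub_T1g_locallyQuasiSplit`: Witt completion of a hyperbolic pair — ★ `exists_isotropic_localGram` (u-invariant `4`) + ★
`exists_hyperbolic_partner_localGram` + the cross-product frame).  This file is its CM instantiation in the binders the line's §6 consumes
(`(cmDatum L 3 H).Local v`, `Φ₃` = the line's `qsForm L` literal, `hns : ∀ w : PlacesOver L v, w̄ = w`) — by name, three short proofs.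
HC_CM is proved only modulo the printed citations until rung 0 closes.

* `exists_formCongr_eq_smul_qsForm` — at a NON-SPLIT `v`: `∃ T ∈ GL₃(L ⊗ L⁺_v), ∃ a` unit, `ᵗ(T̄) · H_v · T = a • (Φ₃)_v` (the census (2)
  body AT `N = 3`, token for token — so a later general-odd-`N` letter would discharge the same shape).
* `nonempty_cmDatum_local_equiv_qsForm` — hence `Nonempty ((cmDatum L 3 H).Local v ≃ₜ* (cmDatum L 3 Φ₃).Local v)` at a non-split `v`
  (★ `cmDatumLocalCongr … |>.symm`, `g ↦ T⁻¹ g T`; `U(a • Φ₃) = U(Φ₃)`).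
* `nonempty_cmDatum_local_equiv_qsForm_forall` — and at EVERY finite place `v` of `L⁺` (split places are free: ★ `cmDatumLocalSplitCongr`,
  both sides `GL₃(L_w)`; ★ `nonempty_cmDatum_local_equiv_of_forall_nonsplit`, ★ `antidiagOne_isHermitian`, ★ `isUnit_antidiagOne_det`).
* `nonempty_cmDatum_local_equiv_qsForm_forall_of_anisotropic` — the line's inner forms (anisotropic `H`: `det ≠ 0` by ★
  `Godement.det_ne_zero_of_anisotropic`).

## References
* [Rogawski1990] J. Rogawski, *Automorphic Representations of Unitary Groups in Three Variables*, Ann. of Math. Stud. 123 (1990), §14.2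
  p. 232 (i)–(iii) («`G′_v` is isomorphic to `G_v` if `v` is finite», `D = M₃(E)`).
* [Jacobowitz1962] R. Jacobowitz, *Hermitian forms over local fields*, Amer. J. Math. 84 (1962), Thm. 3.1.
* [PlatonovRapinchuk1994] V. Platonov, A. Rapinchuk, *Algebraic Groups and Number Theory* (1994), §2.3.
-/

set_option autoImplicit false
set_option linter.dupNamespace false

noncomputable section

namespace Summit.HodgeConjecture.HodgeConjecture.Cruxes.H413.F0P3bNonsplitIdentification

open NumberField IsDedekindDomain
open Literature.NumberTheory.Automorphic Literature.NumberTheory.Automorphic.UnitaryGroup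
open scoped Matrix

variable (L : Type) [Field L] [NumberField L] [IsCMField L]

/-- **E4, the similitude at a non-split place** ([Rogawski1990, §14.2 p. 232 (i)]; [Jacobowitz1962, Thm. 3.1] at rank `3`): for a CM field `L`,
a hermitian `H ∈ M₃(L)` (`ᵗH̄ = H`) with invertible determinant and a finite place `v` of `L⁺` all of whose extensions to `L` are fixed by
complex conjugation (i.e. `v` does NOT split), there are `T ∈ GL₃(L ⊗_{L⁺} L⁺_v)` and a unit `a` with `ᵗ(T̄) · H_v · T = a • (Φ₃)_v`,
`Φ₃ = antidiag(1,1,1)` written as the line's literal `qsForm L`.  BY NAME: ★ `UnitaryGroup.exists_isUnit_formCongr_map_eq_smul_antidiag_of_smul_eq`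
at `c :=` complex conjugation (`c ≠ 1` ★ `IsCMField.complexConj_ne_one`), a place `w ∣ v` existing by ★ `PlacesOver.nonempty`.
[cite: Rogawski1990, §14.2 p. 232] [cite: Jacobowitz1962, Thm. 3.1] -/
theorem exists_formCongr_eq_smul_qsForm (H : Matrix (Fin 3) (Fin 3) L) (hH : (H.map (cmConjRingHom L))ᵀ = H) (hHd : IsUnit H.det)
    (v : HeightOneSpectrum (𝓞 ↥(maximalRealSubfield L))) (hns : ∀ w : PlacesOver L v, IsCMField.complexConj L • w.1 = w.1) :
    ∃ (T : GL (Fin 3) (LocalRing L v)) (a : LocalRing L v), IsUnit a ∧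
      formCongr (conjLocal L (IsCMField.complexConj L) v) T (H.map (algebraMap L (LocalRing L v))) =
        a • (Matrix.of fun i j : Fin 3 => if i.val + j.val + 1 = 3 then (1 : L) else 0).map (algebraMap L (LocalRing L v)) := by
  obtain ⟨w⟩ : Nonempty (PlacesOver L v) := inferInstance
  exact exists_isUnit_formCongr_map_eq_smul_antidiag_of_smul_eq L (IsCMField.complexConj L) (IsCMField.complexConj_ne_one L) H
    ((map_cmConjRingHom_eq_map_complexConj L H) ▸ hH) hHd.ne_zero w (hns w)

/-- **E4, non-split places: the identification EXISTS** — `U(H)(L⁺_v) ≃ₜ* U(Φ₃)(L⁺_v)` on the line's carriers `(cmDatum L 3 ·).Local v`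
(the target IS the line's `Gqs L v`), for `H` hermitian with invertible determinant and `v` non-split: `(cmDatumLocalCongr L v T ha h).symm`,
`g ↦ T⁻¹ g T` (★ `cmDatumLocalCongr`; `U(a • Φ₃) = U(Φ₃)`). [cite: Rogawski1990, §14.2 p. 232] [cite: PlatonovRapinchuk1994, §2.3] -/
theorem nonempty_cmDatum_local_equiv_qsForm (H : Matrix (Fin 3) (Fin 3) L) (hH : (H.map (cmConjRingHom L))ᵀ = H) (hHd : IsUnit H.det)
    (v : HeightOneSpectrum (𝓞 ↥(maximalRealSubfield L))) (hns : ∀ w : PlacesOver L v, IsCMField.complexConj L • w.1 = w.1) :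
    Nonempty ((cmDatum L 3 H).Local v ≃ₜ*
      (cmDatum L 3 (Matrix.of fun i j : Fin 3 => if i.val + j.val + 1 = 3 then (1 : L) else 0)).Local v) := by
  obtain ⟨T, a, ha, h⟩ := exists_formCongr_eq_smul_qsForm L H hH hHd v hns
  exact ⟨(cmDatumLocalCongr L v T ha h).symm⟩

/-- **E4, every finite place**: `U(H)(L⁺_v) ≃ₜ* U(Φ₃)(L⁺_v)` at EVERY finite place `v` of `L⁺`, for `H` hermitian with invertible determinant
— the split places are free (★ `cmDatumLocalSplitCongr`: both sides are `GL₃(L_w)`), the non-split ones are `nonempty_cmDatum_local_equiv_qsForm`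
(★ `nonempty_cmDatum_local_equiv_of_forall_nonsplit`; `Φ₃` hermitian and invertible by ★ `antidiagOne_isHermitian` ∕ ★ `isUnit_antidiagOne_det`;
a place `w ∣ v` with `w̄ = w` is the ONLY place above `v`, ★ `PlacesOver.eq_of_smul_eq`). [cite: Rogawski1990, §14.2 p. 232] -/
theorem nonempty_cmDatum_local_equiv_qsForm_forall (H : Matrix (Fin 3) (Fin 3) L) (hH : (H.map (cmConjRingHom L))ᵀ = H)
    (hHd : IsUnit H.det) (v : HeightOneSpectrum (𝓞 ↥(maximalRealSubfield L))) :
    Nonempty ((cmDatum L 3 H).Local v ≃ₜ*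
      (cmDatum L 3 (Matrix.of fun i j : Fin 3 => if i.val + j.val + 1 = 3 then (1 : L) else 0)).Local v) :=
  nonempty_cmDatum_local_equiv_of_forall_nonsplit L hH hHd (antidiagOne_isHermitian L 3) (isUnit_antidiagOne_det L 3)
    (fun v w hw => by
      obtain ⟨T, a, ha, h⟩ := exists_isUnit_formCongr_map_eq_smul_antidiag_of_smul_eq L (IsCMField.complexConj L)
        (IsCMField.complexConj_ne_one L) H ((map_cmConjRingHom_eq_map_complexConj L H) ▸ hH) hHd.ne_zero w hw
      exact ⟨(cmDatumLocalCongr L v T ha h).symm⟩) v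

/-- **E4 for the line's INNER FORMS** (anisotropic `H`), every finite place: an anisotropic hermitian `H` has `det H ≠ 0`
(★ `Godement.det_ne_zero_of_anisotropic`). [cite: Rogawski1990, §14.2 p. 232] -/
theorem nonempty_cmDatum_local_equiv_qsForm_forall_of_anisotropic (H : Matrix (Fin 3) (Fin 3) L)
    (hanis : ∀ x : Fin 3 → L, Literature.AlgebraicGeometry.ShimuraVarieties.hermForm (cmConjRingHom L) H x x = 0 → x = 0) (hH : (H.map (cmConjRingHom L))ᵀ = H)
    (v : HeightOneSpectrum (𝓞 ↥(maximalRealSubfield L))) :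
    Nonempty ((cmDatum L 3 H).Local v ≃ₜ*
      (cmDatum L 3 (Matrix.of fun i j : Fin 3 => if i.val + j.val + 1 = 3 then (1 : L) else 0)).Local v) :=
  nonempty_cmDatum_local_equiv_qsForm_forall L H hH (isUnit_iff_ne_zero.2 (Godement.det_ne_zero_of_anisotropic L H hanis)) v

end Summit.HodgeConjecture.HodgeConjecture.Cruxes.H413.F0P3bNonsplitIdentification

end
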